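import Literature.Algebra.Lie.SpecialUnitarySimple
import Literature.RepresentationTheory.CompactGroups.MatrixGroupExpSurjective
import Literature.MathematicalPhysics.QuantumLattice.RepLieAlgebraUnitary
import HarnessLib

/-!
# The adjoint action of `U(n)` on `𝔰𝔲(n)` is irreducible, and every unitary matrix centralises a non-zero
# element of `𝔰𝔲(n)` [Hall2015, Thm. 3.20 (1),(4), Prop. 7.31; Sikora2017, §2]

statement-level skeleton of published theorems with citation tags; proofs where landed; nothing here is a claim about
the Yang–Mills mass gap (cell `lit-balaban` page-1 framing sentence — this is a classical support file of that cell, unit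
`lit-balaban-p24`; own-lane free target of the Lie ∕ linear-algebra lineage, no SKELETON row).

Topic `Algebra/Lie`.  Two elementary facts about the traceless skew-Hermitian matrices
`𝔰𝔲(n) = Literature.Algebra.Lie.CompactKillingForm.su n` (a real Lie subalgebra of `M_n(ℂ)`, commutator bracket):

* §1–§2 **IRREDUCIBILITY OF THE ADJOINT ACTION.**  A real linear subspace `W ≤ 𝔰𝔲(n)` which is stable under
  `w ↦ e^{tX} w e^{−tX}` for every `X ∈ 𝔰𝔲(n)` and every real `t` is `0` or all of `𝔰𝔲(n)` (`|n| ≥ 1`;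
  `eq_bot_or_forall_mem_of_forall_conj_exp_mem`).  Proof: differentiating the curve `t ↦ e^{tX} w e^{−tX} ∈ W` at
  `t = 0` inside the closed subspace `W` gives `Xw − wX ∈ W` (Hall, Thm. 3.20 (4); tree
  `MatrixLie.hasDerivAt_conj_exp`, `MatrixLie.mem_of_hasDerivAt_of_forall_mem`), so `W` cuts out a Lie ideal of
  `𝔰𝔲(n)`, which is `⊥` or `⊤` by the simplicity file (tree
  `SpecialUnitarySimple.eq_bot_or_eq_top_of_lieIdeal_su`, Hall Prop. 7.31).  Consequently a subspace of `𝔰𝔲(n)`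
  stable under conjugation by EVERY UNITARY matrix is `0` or `𝔰𝔲(n)` (`eq_bot_or_forall_mem_of_forall_unitary_conj_mem`:
  `e^{tX}` is unitary for skew-Hermitian `X`, tree `exp_mem_unitaryGroup_of_star_eq_neg`).
* §3 **EVERY UNITARY MATRIX CENTRALISES A NON-ZERO ELEMENT OF `𝔰𝔲(n)`** (`|n| ≥ 2`;
  `exists_mem_su_ne_zero_commute`): for `U ∈ U(n)` one of `(U − Uᴴ) − (tr/|n|)·1`, `i(U + Uᴴ) − (tr/|n|)·1` is a
  non-zero traceless skew-Hermitian matrix commuting with `U` (both commute with `U` because `UUᴴ = UᴴU = 1`), unless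
  both vanish, in which case `U` is scalar and commutes with all of `𝔰𝔲(n) ≠ 0`.  (Lie-theoretically: `U` lies in a
  maximal torus of `U(n)`, whose traceless Lie algebra it fixes under `Ad`; the elementary form avoids diagonalisation.)

These are the two inputs «every element of the image has eigenvalue `1`» and «the image is irreducible» of A. S. Sikora's
mechanism [Sikora2017, §2, proof of Theorem «undisting»] — there for `SO(5) → SO(14)` on `Sym²ℂ⁵ ⊖ ℂ`, here for the
adjoint representation `U(3) → SO(𝔰𝔲(3)) = SO(8)` — used by the companion files
`Literature/LinearAlgebra/Matrix/AdjointSU3Orthogonal.lean` and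
`Literature/MathematicalPhysics/QuantumFieldTheory/Balaban1983to89/WilsonLoopsNotCompleteSO8.lean` (cell `lit-balaban`,
unit p24 gen 20) to show that word-wise conjugacy in `SO(8)` does not imply simultaneous conjugacy.

## References

* [Hall2015] B. C. Hall, *Lie Groups, Lie Algebras, and Representations*, 2nd ed., GTM 222 (2015): Theorem 3.20 (1), (4)
  (`A X A⁻¹ ∈ 𝔤`; `d/dt (e^{tX} Y e^{−tX})|₀ = XY − YX`, «using that a real subspace of `M_n(ℂ)` is closed»),
  Proposition 3.24 (`𝔲(n)`, `𝔰𝔲(n)`), Proposition 7.31 / §7.7.1 (`𝔰𝔲(n)` simple).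
* [Sikora2017] A. S. Sikora, *SO(2n,ℂ)-character varieties are not varieties of characters*, J. Algebra 478 (2017)
  195–214 (arXiv:1503.08279), §2.

Mathlib (this pin): `Matrix.unitaryGroup`, `Matrix.mem_unitaryGroup_iff`, `NormedSpace.exp`; no `𝔰𝔲(n)` as a Lie algebra
(tree `CompactKillingForm.su`) and no statement about `Ad`-invariant subspaces of `𝔰𝔲(n)`.  The commutator Lie bracket on
`M_n(ℂ)` is Mathlib's non-instance `LieRing.ofAssociativeRing`, enabled only inside the one proof that needs it.
-/

noncomputable section

open scoped Matrix.Norms.Operator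
open NormedSpace Matrix

namespace Literature.Algebra.Lie.SpecialUnitaryAdjointIrreducible

open Literature.Algebra.Lie.CompactKillingForm (su mem_su_iff)
open Literature.Algebra.Lie.SpecialUnitarySimple (eq_bot_or_eq_top_of_lieIdeal_su exists_ne_zero_su)
open Literature.RepresentationTheory.CompactGroups (MatrixLie.hasDerivAt_conj_exp
  MatrixLie.mem_of_hasDerivAt_of_forall_mem)
open Literature.MathematicalPhysics.QuantumLattice (exp_mem_unitaryGroup_of_star_eq_neg star_smul_of_star_eq_neg)

variable {n : Type*} [Fintype n] [DecidableEq n]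

/-! ## §1 From `Ad(e^{tX})`-stability to `ad X`-stability (Hall, Thm. 3.20 (4)) -/

set_option backward.isDefEq.respectTransparency false in
/-- If the curve `t ↦ e^{tX} w e^{−tX}` stays in a real subspace `W` of `M_n(ℂ)`, then `Xw − wX ∈ W`: differentiate at
`t = 0` inside the (finite-dimensional, hence closed) subspace. [cite: Hall2015, Theorem 3.20 (4)] -/
theorem mul_sub_mul_mem_of_forall_conj_exp_mem (W : Submodule ℝ (Matrix n n ℂ)) {X w : Matrix n n ℂ}
    (h : ∀ t : ℝ, exp (t • X) * w * exp (t • (-X)) ∈ W) : X * w - w * X ∈ W :=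
  MatrixLie.mem_of_hasDerivAt_of_forall_mem W h (MatrixLie.hasDerivAt_conj_exp X w)

/-! ## §2 An `ad`-stable subspace of `𝔰𝔲(n)` is a Lie ideal, hence `⊥` or `⊤`

Statements are phrased with the membership conditions `Xᴴ = −X ∧ tr X = 0` of `𝔰𝔲(n)` written out, so that no Lie-ring
instance on `M_n(ℂ)` is needed to state them; the proofs enable Mathlib's non-instance commutator bracket
`LieRing.ofAssociativeRing` locally and work in the tree's Lie subalgebra `su n` (`mem_su_iff`). -/

/-- **An `ad(𝔰𝔲(n))`-stable real subspace of `𝔰𝔲(n)` is `0` or `𝔰𝔲(n)`** (`|n| ≥ 1`): the subspace cuts out a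
Lie ideal `{y ∈ 𝔰𝔲(n) | y ∈ W}` of `𝔰𝔲(n)`, which is `⊥` or `⊤` by the simplicity of `𝔰𝔲(n)` (`|n| ≥ 2`; for
`|n| = 1`, `𝔰𝔲(n) = 0`). [cite: Hall2015, Proposition 7.31] -/
theorem eq_bot_or_forall_mem_of_lie_stable [Nonempty n] (W : Submodule ℝ (Matrix n n ℂ))
    (hle : ∀ X ∈ W, Xᴴ = -X ∧ X.trace = 0)
    (hlie : ∀ X : Matrix n n ℂ, Xᴴ = -X → X.trace = 0 → ∀ w ∈ W, X * w - w * X ∈ W) :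
    W = ⊥ ∨ ∀ X : Matrix n n ℂ, Xᴴ = -X → X.trace = 0 → X ∈ W := by
  -- Mathlib idiom: the commutator bracket on `M_n(ℂ)` (`LieRing.ofAssociativeRing`), enabled inside this proof only
  letI : LieRing (Matrix n n ℂ) := LieRing.ofAssociativeRing
  letI : LieAlgebra ℝ (Matrix n n ℂ) := LieAlgebra.ofAssociativeAlgebra
  -- the Lie ideal of `𝔰𝔲(n)` cut out by `W`
  let I : LieIdeal ℝ (su n) :=
    { carrier := {y | (y : Matrix n n ℂ) ∈ W}
      add_mem' := fun {y z} hy hz => by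
        simp only [Set.mem_setOf_eq, AddMemClass.coe_add] at hy hz ⊢
        exact W.add_mem hy hz
      zero_mem' := by
        change ((0 : su n) : Matrix n n ℂ) ∈ W
        rw [ZeroMemClass.coe_zero]
        exact W.zero_mem
      smul_mem' := fun c {y} hy => by
        simp only [Set.mem_setOf_eq, SetLike.val_smul] at hy ⊢
        exact W.smul_mem c hy
      lie_mem := fun {y z} hz => by
        simp only [Set.mem_setOf_eq, LieSubalgebra.coe_bracket, LieRing.of_associative_ring_bracket] at hz ⊢
        exact hlie y (mem_su_iff.1 y.2).1 (mem_su_iff.1 y.2).2 z hz }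
  have hI : ∀ y : su n, y ∈ I ↔ (y : Matrix n n ℂ) ∈ W := fun y => Iff.rfl
  rcases eq_bot_or_eq_top_of_lieIdeal_su I with hbot | htop
  · left
    rw [eq_bot_iff]
    intro w hw
    rw [Submodule.mem_bot]
    have hmem : (⟨w, mem_su_iff.2 (hle w hw)⟩ : su n) ∈ I := (hI _).2 hw
    rw [hbot, LieSubmodule.mem_bot] at hmem
    exact congrArg Subtype.val hmem
  · right
    intro X hX htr
    have hmem : (⟨X, mem_su_iff.2 ⟨hX, htr⟩⟩ : su n) ∈ I := by
      rw [htop]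
      exact LieSubmodule.mem_top _
    exact (hI _).1 hmem

/-- **IRREDUCIBILITY OF THE ADJOINT ACTION, one-parameter form**: a real subspace `W ≤ 𝔰𝔲(n)` stable under
`w ↦ e^{tX} w e^{−tX}` for all `X ∈ 𝔰𝔲(n)`, `t ∈ ℝ` is `0` or `𝔰𝔲(n)` (`|n| ≥ 1`).
[cite: Hall2015, Theorem 3.20 (4), Proposition 7.31] -/
theorem eq_bot_or_forall_mem_of_forall_conj_exp_mem [Nonempty n] (W : Submodule ℝ (Matrix n n ℂ))
    (hle : ∀ X ∈ W, Xᴴ = -X ∧ X.trace = 0)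
    (hinv : ∀ X : Matrix n n ℂ, Xᴴ = -X → X.trace = 0 → ∀ t : ℝ, ∀ w ∈ W, exp (t • X) * w * exp (t • (-X)) ∈ W) :
    W = ⊥ ∨ ∀ X : Matrix n n ℂ, Xᴴ = -X → X.trace = 0 → X ∈ W :=
  eq_bot_or_forall_mem_of_lie_stable W hle fun X hX htr w hw =>
    mul_sub_mul_mem_of_forall_conj_exp_mem W fun t => hinv X hX htr t w hw

/-- For skew-Hermitian `X` and real `t`, `(e^{tX})* = e^{−tX}`. [cite: Hall2015, Proposition 3.24] -/
theorem star_exp_smul_of_conjTranspose_eq_neg {X : Matrix n n ℂ} (hX : Xᴴ = -X) (t : ℝ) :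
    star (exp (t • X)) = exp (t • (-X)) := by
  rw [star_exp, ← Matrix.star_eq_conjTranspose] at *
  rw [star_smul_of_star_eq_neg hX t, smul_neg]

/-- **IRREDUCIBILITY OF THE ADJOINT ACTION OF `U(n)` ON `𝔰𝔲(n)`**: a real subspace `W ≤ 𝔰𝔲(n)` with
`U W U* ⊆ W` for every unitary `U` is `0` or `𝔰𝔲(n)` (`|n| ≥ 1`).  (Take `U = e^{tX}`, `X ∈ 𝔰𝔲(n) ⊆ 𝔲(n)`.)
[cite: Hall2015, Theorem 3.20 (1),(4), Proposition 7.31] -/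
theorem eq_bot_or_forall_mem_of_forall_unitary_conj_mem [Nonempty n] (W : Submodule ℝ (Matrix n n ℂ))
    (hle : ∀ X ∈ W, Xᴴ = -X ∧ X.trace = 0)
    (hinv : ∀ U ∈ Matrix.unitaryGroup n ℂ, ∀ w ∈ W, U * w * star U ∈ W) :
    W = ⊥ ∨ ∀ X : Matrix n n ℂ, Xᴴ = -X → X.trace = 0 → X ∈ W := by
  refine eq_bot_or_forall_mem_of_forall_conj_exp_mem W hle fun X hX _ t w hw => ?_
  have hXs : star X = -X := by rw [Matrix.star_eq_conjTranspose]; exact hX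
  have hU : exp (t • X) ∈ Matrix.unitaryGroup n ℂ :=
    exp_mem_unitaryGroup_of_star_eq_neg (star_smul_of_star_eq_neg hXs t)
  have h := hinv _ hU w hw
  rwa [star_exp_smul_of_conjTranspose_eq_neg hX t] at h

/-! ## §3 Every unitary matrix centralises a non-zero element of `𝔰𝔲(n)` -/

/-- For unitary `U`, `U` commutes with `U − Uᴴ`. [folklore] -/
private theorem mul_sub_conjTranspose_comm {U : Matrix n n ℂ} (hU : U ∈ Matrix.unitaryGroup n ℂ) :
    U * (U - Uᴴ) = (U - Uᴴ) * U := by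
  have h1 : U * Uᴴ = 1 := by
    have := Matrix.mem_unitaryGroup_iff.1 hU; rwa [Matrix.star_eq_conjTranspose] at this
  have h2 : Uᴴ * U = 1 := by
    have := Matrix.mem_unitaryGroup_iff'.1 hU; rwa [Matrix.star_eq_conjTranspose] at this
  rw [Matrix.mul_sub, Matrix.sub_mul, h1, h2]

/-- For unitary `U`, `U` commutes with `U + Uᴴ`. [folklore] -/
private theorem mul_add_conjTranspose_comm {U : Matrix n n ℂ} (hU : U ∈ Matrix.unitaryGroup n ℂ) :
    U * (U + Uᴴ) = (U + Uᴴ) * U := by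
  have h1 : U * Uᴴ = 1 := by
    have := Matrix.mem_unitaryGroup_iff.1 hU; rwa [Matrix.star_eq_conjTranspose] at this
  have h2 : Uᴴ * U = 1 := by
    have := Matrix.mem_unitaryGroup_iff'.1 hU; rwa [Matrix.star_eq_conjTranspose] at this
  rw [Matrix.mul_add, Matrix.add_mul, h1, h2]

/-- The traceless part `A − (tr A/|n|)·1` of a skew-Hermitian matrix is traceless skew-Hermitian. [folklore] -/
private theorem sub_trace_smul_one_mem_su [Nonempty n] {A : Matrix n n ℂ} (hA : Aᴴ = -A) :
    (A - (A.trace / Fintype.card n) • (1 : Matrix n n ℂ))ᴴ = -(A - (A.trace / Fintype.card n) • (1 : Matrix n n ℂ)) ∧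
      (A - (A.trace / Fintype.card n) • (1 : Matrix n n ℂ)).trace = 0 := by
  have hcard : (Fintype.card n : ℂ) ≠ 0 := Nat.cast_ne_zero.2 Fintype.card_ne_zero
  have htr : star A.trace = -A.trace := by
    rw [← Matrix.trace_conjTranspose, hA, Matrix.trace_neg]
  refine ⟨?_, ?_⟩
  · rw [conjTranspose_sub, conjTranspose_smul, conjTranspose_one, hA, star_div₀, htr, Complex.star_def,
      Complex.conj_natCast, neg_div, neg_smul, neg_sub_neg, neg_sub]
  · rw [trace_sub, trace_smul, trace_one, smul_eq_mul, div_mul_cancel₀ _ hcard, sub_self]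

/-- A matrix commuting with `A` commutes with its traceless part. [folklore] -/
private theorem comm_sub_trace_smul_one {U A : Matrix n n ℂ} (h : U * A = A * U) (c : ℂ) :
    U * (A - c • (1 : Matrix n n ℂ)) = (A - c • (1 : Matrix n n ℂ)) * U := by
  rw [Matrix.mul_sub, Matrix.sub_mul, h, Matrix.mul_smul, Matrix.smul_mul, Matrix.mul_one, Matrix.one_mul]

omit [Fintype n] in
/-- If both traceless parts `(U − Uᴴ)₀` and `(i(U + Uᴴ))₀` vanish, `U` is a scalar matrix. [folklore] -/
private theorem exists_eq_smul_one_of_parts_eq_zero [Nonempty n] {U : Matrix n n ℂ} {a b : ℂ}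
    (h₁ : U - Uᴴ - a • (1 : Matrix n n ℂ) = 0) (h₂ : Complex.I • (U + Uᴴ) - b • (1 : Matrix n n ℂ) = 0) :
    ∃ c : ℂ, U = c • (1 : Matrix n n ℂ) := by
  rw [sub_eq_zero] at h₁ h₂
  have h₂' : U + Uᴴ = (-Complex.I * b) • (1 : Matrix n n ℂ) := by
    have := congrArg (fun M : Matrix n n ℂ => (-Complex.I) • M) h₂
    simp only [smul_smul] at this
    rw [← this, neg_mul, Complex.I_mul_I, neg_neg, one_smul]
  refine ⟨(a + -Complex.I * b) / 2, ?_⟩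
  have hsum : U + U = (a + -Complex.I * b) • (1 : Matrix n n ℂ) := by
    rw [add_smul, ← h₁, ← h₂']; abel
  rw [div_eq_mul_inv, mul_comm, ← smul_smul, ← hsum, smul_add, ← add_smul]
  norm_num

/-- **EVERY UNITARY MATRIX COMMUTES WITH A NON-ZERO ELEMENT OF `𝔰𝔲(n)`** (`|n| ≥ 2`): the input «every element
of the image has eigenvalue `1`» of Sikora's mechanism, for the adjoint representation.  Lie-theoretically: `U`
lies in a maximal torus of `U(n)` and `Ad U` fixes its (traceless) Lie algebra; the proof here is the elementary
normal-form-free one described in the header. [cite: Sikora2017, §2 (proof of Theorem «undisting»)] -/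
theorem exists_mem_su_ne_zero_commute (hn : 1 < Fintype.card n) {U : Matrix n n ℂ}
    (hU : U ∈ Matrix.unitaryGroup n ℂ) :
    ∃ X : Matrix n n ℂ, (Xᴴ = -X ∧ X.trace = 0) ∧ X ≠ 0 ∧ U * X = X * U := by
  haveI : Nonempty n := Fintype.card_pos_iff.1 (by omega)
  letI : LieRing (Matrix n n ℂ) := LieRing.ofAssociativeRing
  letI : LieAlgebra ℝ (Matrix n n ℂ) := LieAlgebra.ofAssociativeAlgebra
  -- the two candidates
  set A : Matrix n n ℂ := U - Uᴴ with hA_def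
  set B : Matrix n n ℂ := Complex.I • (U + Uᴴ) with hB_def
  have hA : Aᴴ = -A := by rw [hA_def, conjTranspose_sub, conjTranspose_conjTranspose, neg_sub]
  have hB : Bᴴ = -B := by
    rw [hB_def, conjTranspose_smul, conjTranspose_add, conjTranspose_conjTranspose, Complex.star_def,
      Complex.conj_I, neg_smul, add_comm]
  have hUA : U * A = A * U := mul_sub_conjTranspose_comm hU
  have hUB : U * B = B * U := by rw [hB_def, Matrix.mul_smul, Matrix.smul_mul, mul_add_conjTranspose_comm hU]
  set X₁ : Matrix n n ℂ := A - (A.trace / Fintype.card n) • (1 : Matrix n n ℂ) with hX₁_def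
  set X₂ : Matrix n n ℂ := B - (B.trace / Fintype.card n) • (1 : Matrix n n ℂ) with hX₂_def
  by_cases h₁ : X₁ = 0
  · by_cases h₂ : X₂ = 0
    · -- `U` is scalar: any non-zero element of `𝔰𝔲(n)` will do
      obtain ⟨c, hc⟩ := exists_eq_smul_one_of_parts_eq_zero (n := n) h₁ h₂
      obtain ⟨Y, hY⟩ := exists_ne_zero_su hn
      refine ⟨Y, mem_su_iff.1 Y.2, fun h0 => hY (Subtype.ext h0), ?_⟩
      rw [hc, Matrix.smul_mul, Matrix.mul_smul, Matrix.one_mul, Matrix.mul_one]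
    · exact ⟨X₂, sub_trace_smul_one_mem_su hB, h₂, comm_sub_trace_smul_one hUB _⟩
  · exact ⟨X₁, sub_trace_smul_one_mem_su hA, h₁, comm_sub_trace_smul_one hUA _⟩

/-- Group-element form: for `U ∈ U(n)` (`|n| ≥ 2`) there is a non-zero `X ∈ 𝔰𝔲(n)` FIXED by `Ad U`:
`U X U* = X`. [cite: Sikora2017, §2 (proof of Theorem «undisting»)] -/
theorem exists_mem_su_ne_zero_conj_eq (hn : 1 < Fintype.card n) {U : Matrix n n ℂ}
    (hU : U ∈ Matrix.unitaryGroup n ℂ) :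
    ∃ X : Matrix n n ℂ, (Xᴴ = -X ∧ X.trace = 0) ∧ X ≠ 0 ∧ U * X * star U = X := by
  obtain ⟨X, hXsu, hX0, hcomm⟩ := exists_mem_su_ne_zero_commute hn hU
  refine ⟨X, hXsu, hX0, ?_⟩
  rw [hcomm, Matrix.mul_assoc, Matrix.mem_unitaryGroup_iff.1 hU, Matrix.mul_one]

end Literature.Algebra.Lie.SpecialUnitaryAdjointIrreducible
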